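import Summits.NavierStokesRegularity.OSWSelfSimilar.SheetRWeakZeroParity
import Mathlib.Analysis.Distribution.AEEqOfIntegralContDiff
import HarnessLib

/-!
# SHEET-ℝ weak→classical bridge, a.e.-class form with parity: an a.e.-ODD `H¹` pair tested against ODD functions

HONEST FRAMING (cell ns-blowup GROUP B / zone Z3, case Z3-SR-CERT; 1-D MODEL (viscous gCLM/OSW on the line); not Euler/NS;
«violates: none — MODEL»). Nothing here asserts that a profile exists.

This is the form in which a concrete instantiation of the certificate's ODD energy space `E = H¹_{L²+ξ²}` delivers its zero: an a.e.-class
`Ω ∈ L¹ ∩ L²`, odd almost everywhere, with a weak derivative `Ω₁ ∈ L²` (`∫Ωψ′ = −∫Ω₁ψ`), and the weak profile equation (W) tested ONLY against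
odd `C_c^∞` functions (the pairing `⟨G(Ω), wφ⟩ = 0`, `φ ∈ E`).  Steps (all kernel): the weak derivative of an a.e.-odd function is a.e. even
(`ae_even_weakDeriv_of_ae_odd`, fundamental lemma of the calculus of variations); the even symmetrisation `Ω₁ᵉ = ½(Ω₁ + Ω₁∘neg)` equals `Ω₁` a.e.;
the continuous representative `Ω̃ = c + ∫₀Ω₁ᵉ` (`SheetRWeakToStrongAE`) is odd POINTWISE (`c = 0` is forced by a.e.-oddness); the tree's p.v.
Hilbert transform and all pairings are unchanged under the a.e. modifications; `SheetRWeakZeroParity` (odd tests suffice) and `SheetRWeakToStrong`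
then give a `C²` strong zero and the exact self-similar viscous gCLM blow-up (`exact_viscous_selfSimilar_blowup_of_weakDeriv_odd`).
Pure calculus; no definition, no named fact.  WHAT THIS IS NOT: not NS; not the MODEL ASSEMBLY (which must still supply the pair and (W)).
-/

noncomputable section

namespace Summit.NavierStokesRegularity.OSWSelfSimilar
namespace SheetRWeakZeroParity

open _root_.MeasureTheory _root_.Set _root_.Filter _root_.Function Literature.Analysis.Fourier Literature.Analysis.FluidPDE
  SheetRWeakProfilePV SheetRWeakToStrong SheetRWeakToStrongAE
open scoped Real Topology ContDiff

/-- Composition of an a.e. statement with the reflection `y ↦ −y` (measure preserving). [folklore] -/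
theorem ae_comp_neg {p : ℝ → Prop} (h : ∀ᵐ y : ℝ, p y) : ∀ᵐ y : ℝ, p (-y) :=
  (Measure.measurePreserving_neg (volume : Measure ℝ)).quasiMeasurePreserving.tendsto_ae.eventually h

/-- **The weak derivative of an a.e.-odd function is a.e. even.** If `Ω₁ ∈ L²`, `∫Ωψ′ = −∫Ω₁ψ` for all `C_c^∞` tests and
`Ω(−y) = −Ω(y)` for a.e. `y`, then `Ω₁(−y) = Ω₁(y)` for a.e. `y`. [folklore] -/
theorem ae_even_weakDeriv_of_ae_odd {Ω Ω₁ : ℝ → ℝ} (hΩ₁ : MemLp Ω₁ 2)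
    (hwd : ∀ ψ : ℝ → ℝ, ContDiff ℝ ∞ ψ → HasCompactSupport ψ → ∫ x, Ω x * deriv ψ x = -∫ x, Ω₁ x * ψ x)
    (hodd : ∀ᵐ y : ℝ, Ω (-y) = -Ω y) : ∀ᵐ y : ℝ, Ω₁ (-y) = Ω₁ y := by
  have hΩ₁n : MemLp (fun y => Ω₁ (-y)) 2 := hΩ₁.comp_measurePreserving (Measure.measurePreserving_neg volume)
  have hΩ₁loc : LocallyIntegrable Ω₁ := hΩ₁.locallyIntegrable one_le_two
  have hΩ₁nloc : LocallyIntegrable (fun y => Ω₁ (-y)) := hΩ₁n.locallyIntegrable one_le_two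
  have hD : ∀ᵐ y : ℝ, Ω₁ (-y) - Ω₁ y = 0 := by
    refine ae_eq_zero_of_integral_contDiff_smul_eq_zero (hΩ₁nloc.sub hΩ₁loc) fun g hg hgc => ?_
    have hgc' : Continuous g := hg.continuous
    have hi1 : Integrable fun y => g y * Ω₁ (-y) := by
      simpa only [smul_eq_mul] using hΩ₁nloc.integrable_smul_left_of_hasCompactSupport hgc' hgc
    have hi2 : Integrable fun y => g y * Ω₁ y := by
      simpa only [smul_eq_mul] using hΩ₁loc.integrable_smul_left_of_hasCompactSupport hgc' hgc
    -- the test function `ψ = g ∘ neg`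
    have hψ : ContDiff ℝ ∞ fun y => g (-y) := hg.comp contDiff_neg
    have hψc : HasCompactSupport fun y => g (-y) := hgc.comp_homeomorph (Homeomorph.neg ℝ)
    have hdψ : ∀ y, deriv (fun y => g (-y)) y = -deriv g (-y) := fun y => deriv_comp_neg g y
    have h1 := hwd (fun y => g (-y)) hψ hψc
    -- ∫ Ω(y)·(−g′(−y)) dy = −∫ Ω(−y) g′(y)… = ∫ Ω(y) g′(y) dy  (a.e. oddness)
    have h2 : ∫ x, Ω x * deriv (fun y => g (-y)) x = ∫ x, Ω x * deriv g x := by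
      have e1 : ∫ x, Ω x * deriv (fun y => g (-y)) x = ∫ x, -(Ω x * deriv g (-x)) :=
        integral_congr_ae (Eventually.of_forall fun x => by
          show Ω x * deriv (fun y => g (-y)) x = -(Ω x * deriv g (-x)); rw [hdψ]; ring)
      have e2 : ∫ x, -(Ω x * deriv g (-x)) = ∫ x, -(Ω (-x) * deriv g x) := by
        rw [← integral_neg_eq_self (fun x => -(Ω x * deriv g (-x))) volume]
        simp only [neg_neg]
      have e3 : ∫ x, -(Ω (-x) * deriv g x) = ∫ x, Ω x * deriv g x :=
        integral_congr_ae (hodd.mono fun x hx => by show -(Ω (-x) * deriv g x) = Ω x * deriv g x; rw [hx]; ring)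
      rw [e1, e2, e3]
    -- ∫ Ω₁(y) g(−y) dy = ∫ Ω₁(−y) g(y) dy
    have h3 : ∫ x, Ω₁ x * g (-x) = ∫ x, g x * Ω₁ (-x) := by
      rw [← integral_neg_eq_self (fun x => Ω₁ x * g (-x)) volume]
      exact integral_congr_ae (Eventually.of_forall fun x => by simp only [neg_neg]; ring)
    have h4 := hwd g hg hgc
    have h5 : ∫ x, Ω₁ x * g x = ∫ x, g x * Ω₁ x := integral_congr_ae (Eventually.of_forall fun x => mul_comm _ _)
    have e : (fun y => g y • (Ω₁ (-y) - Ω₁ y)) = fun y => g y * Ω₁ (-y) - g y * Ω₁ y := by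
      funext y; rw [smul_eq_mul]; ring
    rw [e, integral_sub hi1 hi2, ← h3, ← h5]
    linarith
  exact hD.mono fun y hy => by linarith

/-- **Odd continuous representative with an even derivative datum.** For an a.e.-odd `Ω ∈ L¹ ∩ L²` with weak derivative `Ω₁ ∈ L²`
there are `Ω'`, `Ω₁'` with `Ω' = Ω` a.e., `Ω₁' = Ω₁` a.e., `Ω'` odd and `Ω₁'` even POINTWISE, `Ω' = Ω'(0) + ∫₀Ω₁'`, `Ω₁' ∈ L²`,
`Ω' ∈ L¹ ∩ L²`, and `HΩ' = HΩ`. [folklore] -/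
theorem exists_odd_representative {Ω Ω₁ : ℝ → ℝ} (hΩi : Integrable Ω) (hΩ2 : MemLp Ω 2) (hΩ₁ : MemLp Ω₁ 2)
    (hodd : ∀ᵐ y : ℝ, Ω (-y) = -Ω y)
    (hwd : ∀ ψ : ℝ → ℝ, ContDiff ℝ ∞ ψ → HasCompactSupport ψ → ∫ x, Ω x * deriv ψ x = -∫ x, Ω₁ x * ψ x) :
    ∃ Ω' Ω₁' : ℝ → ℝ, Ω' =ᵐ[volume] Ω ∧ Ω₁' =ᵐ[volume] Ω₁ ∧ (∀ y, Ω' (-y) = -Ω' y) ∧ (∀ y, Ω₁' (-y) = Ω₁' y) ∧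
      (∀ x, Ω' x = Ω' 0 + ∫ s in (0 : ℝ)..x, Ω₁' s) ∧ MemLp Ω₁' 2 ∧ Integrable Ω' ∧ MemLp Ω' 2 ∧
      hilbertTransform Ω' = hilbertTransform Ω := by
  have heven : ∀ᵐ y : ℝ, Ω₁ (-y) = Ω₁ y := ae_even_weakDeriv_of_ae_odd hΩ₁ hwd hodd
  -- even symmetrisation of `Ω₁`
  set Ω₁' : ℝ → ℝ := fun y => 2⁻¹ * (Ω₁ y + Ω₁ (-y)) with hΩ₁'
  have hΩ₁'e : ∀ y, Ω₁' (-y) = Ω₁' y := fun y => by simp only [hΩ₁', neg_neg]; ring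
  have hΩ₁'ae : Ω₁' =ᵐ[volume] Ω₁ := heven.mono fun y hy => by simp only [hΩ₁', hy]; ring
  have hΩ₁'2 : MemLp Ω₁' 2 := hΩ₁.ae_eq hΩ₁'ae.symm
  -- continuous representative from the weak derivative
  obtain ⟨c, hc⟩ := ae_eq_const_add_primitive_of_weakDeriv hΩi.locallyIntegrable (hΩ₁.locallyIntegrable one_le_two) hwd
  set Ω' : ℝ → ℝ := fun x => c + ∫ s in (0 : ℝ)..x, Ω₁' s with hΩ'
  have hint_eq : ∀ x, ∫ s in (0 : ℝ)..x, Ω₁' s = ∫ s in (0 : ℝ)..x, Ω₁ s := fun x =>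
    intervalIntegral.integral_congr_ae (hΩ₁'ae.mono fun s hs _ => hs)
  have hae : Ω' =ᵐ[volume] Ω := hc.mono fun x hx => by rw [hΩ', hx]; simp only [hint_eq x]
  have hprim : ∀ x, Ω' x = Ω' 0 + ∫ s in (0 : ℝ)..x, Ω₁' s := fun x => by
    simp only [hΩ', intervalIntegral.integral_same, add_zero]
  -- `Ω'(−x) = 2c − Ω'(x)` pointwise, and a.e.-oddness forces `c = 0`
  have hrefl : ∀ x, Ω' (-x) = 2 * c - Ω' x := by
    intro x
    simp only [hΩ']
    have h1 : ∫ s in (0 : ℝ)..x, Ω₁' s = ∫ s in (0 : ℝ)..x, Ω₁' (-s) :=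
      intervalIntegral.integral_congr fun s _ => (hΩ₁'e s).symm
    rw [h1, intervalIntegral.integral_comp_neg, neg_zero, intervalIntegral.integral_symm]
    ring
  have hc0 : c = 0 := by
    have h1 : ∀ᵐ x : ℝ, Ω' (-x) = -Ω' x := by
      filter_upwards [hae, ae_comp_neg (p := fun y => Ω' y = Ω y) hae, hodd] with x h0 h1 h2
      rw [h1, h2, h0]
    have h2 : ∀ᵐ x : ℝ, c = 0 := h1.mono fun x hx => by rw [hrefl] at hx; linarith
    by_contra hc
    have h3 : ∀ᵐ x : ℝ, False := h2.mono fun x hx => hc hx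
    have h4 := ae_iff.1 h3
    simp only [not_false_eq_true, setOf_true] at h4
    exact absurd h4 (by rw [Real.volume_univ]; exact ENNReal.top_ne_zero)
  have hΩ'odd : ∀ y, Ω' (-y) = -Ω' y := fun y => by rw [hrefl, hc0]; ring
  have hΩ'i : Integrable Ω' := hΩi.congr hae.symm
  have hΩ'2 : MemLp Ω' 2 := hΩ2.ae_eq hae.symm
  exact ⟨Ω', Ω₁', hae, hΩ₁'ae, hΩ'odd, hΩ₁'e, hprim, hΩ₁'2, hΩ'i, hΩ'2, hilbertTransform_congr_ae hae⟩

/-- **The bridge in the form the odd energy space delivers it.** Let `Ω ∈ L¹ ∩ L²` be odd a.e., not a.e. zero, with a weak derivative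
`Ω₁ ∈ L²` (`∫Ωψ′ = −∫Ω₁ψ` for all `C_c^∞` tests), `ν ≠ 0`, and assume the weak profile equation (W) of `SheetRWeakToStrong` against all ODD
`C_c^∞` tests.  Then the odd continuous representative `Ω̃ = Ω` a.e. is `C²` and, for every `T > 0`, the self-similar function
`ω(t,x) = (T − t)⁻¹Ω̃(x/√(T − t))` is a classical solution of `ω_t + a u ω_x = u_x ω + ν ω_xx` on `ℝ × [0,T)` whose sup norm blows up at `T`.
MODEL statement; no profile is asserted to exist. [folklore] -/
theorem exact_viscous_selfSimilar_blowup_of_weakDeriv_odd {a ν T : ℝ} {Ω Ω₁ : ℝ → ℝ} (hT : 0 < T) (hν : ν ≠ 0)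
    (hΩi : Integrable Ω) (hΩ2 : MemLp Ω 2) (hΩ₁ : MemLp Ω₁ 2) (hodd : ∀ᵐ y : ℝ, Ω (-y) = -Ω y) (hne : ¬ Ω =ᵐ[volume] 0)
    (hwd : ∀ ψ : ℝ → ℝ, ContDiff ℝ ∞ ψ → HasCompactSupport ψ → ∫ x, Ω x * deriv ψ x = -∫ x, Ω₁ x * ψ x)
    (hweak : ∀ ψ : ℝ → ℝ, ContDiff ℝ ∞ ψ → HasCompactSupport ψ → (∀ y, ψ (-y) = -ψ y) →
      (∫ x, (Ω x + 1 / 2 * x * Ω₁ x + a * (∫ s in (0 : ℝ)..x, hilbertTransform Ω s) * Ω₁ x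
        - hilbertTransform Ω x * Ω x) * ψ x) + ν * ∫ x, Ω₁ x * deriv ψ x = 0) :
    ∃ Ω' : ℝ → ℝ, Ω' =ᵐ[volume] Ω ∧ (∀ y, Ω' (-y) = -Ω' y) ∧ ContDiff ℝ 2 Ω' ∧
      IsGCLMLineSolution a ν (gclmSelfSimilar (-1) (1 / 2) T Ω') T ∧
      SupNormBlowupBefore (gclmSelfSimilar (-1) (1 / 2) T Ω') T := by
  obtain ⟨Ω', Ω₁', hae, hae₁, hΩ'odd, hΩ₁'e, hprim, hΩ₁'2, hΩ'i, hΩ'2, hH⟩ :=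
    exists_odd_representative hΩi hΩ2 hΩ₁ hodd hwd
  -- transfer (W) (odd tests) to the representatives
  have hweak' : ∀ ψ : ℝ → ℝ, ContDiff ℝ ∞ ψ → HasCompactSupport ψ → (∀ y, ψ (-y) = -ψ y) →
      (∫ x, (Ω' x + 1 / 2 * x * Ω₁' x + a * (∫ s in (0 : ℝ)..x, hilbertTransform Ω' s) * Ω₁' x
        - hilbertTransform Ω' x * Ω' x) * ψ x) + ν * ∫ x, Ω₁' x * deriv ψ x = 0 := by
    intro ψ hψ hψc hψo
    rw [hH]
    have e1 : ∫ x, (Ω' x + 1 / 2 * x * Ω₁' x + a * (∫ s in (0 : ℝ)..x, hilbertTransform Ω s) * Ω₁' x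
        - hilbertTransform Ω x * Ω' x) * ψ x = ∫ x, (Ω x + 1 / 2 * x * Ω₁ x
        + a * (∫ s in (0 : ℝ)..x, hilbertTransform Ω s) * Ω₁ x - hilbertTransform Ω x * Ω x) * ψ x := by
      refine integral_congr_ae ?_
      filter_upwards [hae, hae₁] with x hx hx₁
      simp only [hx, hx₁]
    have e2 : ∫ x, Ω₁' x * deriv ψ x = ∫ x, Ω₁ x * deriv ψ x :=
      integral_congr_ae (hae₁.mono fun x hx => by simp only [hx])
    rw [e1, e2]
    exact hweak ψ hψ hψc hψo
  have hC := contDiff_two_and_strongZero_of_odd_tests hν hΩ'odd hΩ₁'e hprim hΩ₁'2 hΩ'i hΩ'2 hweak'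
  have hX : ∃ X₀, Ω' X₀ ≠ 0 := by
    by_contra hcon
    exact hne (hae.symm.trans (Eventually.of_forall fun x => not_not.1 (not_exists.1 hcon x)))
  obtain ⟨X₀, hX₀⟩ := hX
  exact ⟨Ω', hae, hΩ'odd, hC.1,
    SheetRStrongZeroBlowup.exact_viscous_selfSimilar_blowup_of_strongZero hT hC.1 hΩ'i hC.2 hX₀⟩

end SheetRWeakZeroParity
end Summit.NavierStokesRegularity.OSWSelfSimilar

end
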